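import Literature.Probability.LatticeModels.MedialCornerWalk
import HarnessLib

/-!
# Corner walks along lattice paths, II: straight runs

Topic `Literature/Probability/LatticeModels`; a small companion of `MedialCornerWalk.lean` (corner walks
of lattice vertex paths: `pathVerts`, `pathEnd`, `cornerWalk`, `walkTurns`, `lastDir`). The escape paths of
boundary darts used in "the winding at a boundary edge is deterministic" (Duminil-Copin–Hongler–Nolin
2011, Lemma 12) are built from STRAIGHT RUNS `List.replicate n k` of lattice steps; this file records the
bookkeeping of direction lists under concatenation and for runs:

* `pathVerts_append`, `pathEnd_append`, `length_pathVerts`, `lastDir_append_of_ne_nil`,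
  `lastDir_replicate_succ`, `length_le_length_cornerWalk`;
* `pathEnd_replicate` (`z + n • u_k`), `mem_pathVerts_replicate` (the vertices of a run are the
  `z + i • u_k`, `i < n`), `nodup_pathVerts_replicate`;
* `walkTurns_replicate_append` — a straight run entered straight contributes no turn, whatever follows.

Pure list combinatorics; everything is proved.

## References

* H. Duminil-Copin, C. Hongler, P. Nolin, Comm. Pure Appl. Math. 64 (2011), Lemma 12.
  [DuminilCopinHonglerNolin2011]
* S. Smirnov, Ann. of Math. 172 (2010), §4. [Smirnov2010]
-/

namespace Literature.Probability.LatticeModels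

open MedialTrail

/-! ### Concatenation -/

/-- The vertices of a concatenated path: those of the first part, then those of the second part
started at the end vertex of the first. [folklore] -/
theorem pathVerts_append (z : Site 2) (ks ks' : List (Fin 4)) :
    pathVerts z (ks ++ ks') = pathVerts z ks ++ pathVerts (pathEnd z ks) ks' := by
  induction ks generalizing z with
  | nil => rfl
  | cons k ks ih => simp [pathVerts, pathEnd, ih]

/-- The end vertex of a concatenated path. [folklore] -/
theorem pathEnd_append (z : Site 2) (ks ks' : List (Fin 4)) :
    pathEnd z (ks ++ ks') = pathEnd (pathEnd z ks) ks' := by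
  induction ks generalizing z with
  | nil => rfl
  | cons k ks ih => simp [pathEnd, ih]

/-- A path with `n` steps lists `n` vertices (the final one excluded). [folklore] -/
theorem length_pathVerts (z : Site 2) (ks : List (Fin 4)) : (pathVerts z ks).length = ks.length := by
  induction ks generalizing z with
  | nil => rfl
  | cons k ks ih => simp [pathVerts, ih]

/-- The first vertex of a nonempty path is its start. [folklore] -/
theorem head?_pathVerts (z : Site 2) {ks : List (Fin 4)} (hks : ks ≠ []) : (pathVerts z ks).head? = some z := by
  obtain ⟨k, ks, rfl⟩ := List.exists_cons_of_ne_nil hks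
  rfl

/-- The vertices of a one-step extension. [folklore] -/
theorem pathVerts_cons (z : Site 2) (k : Fin 4) (ks : List (Fin 4)) :
    pathVerts z (k :: ks) = z :: pathVerts (z + cornerUnit k) ks := rfl

/-- The end vertex after one step. [folklore] -/
theorem pathEnd_cons (z : Site 2) (k : Fin 4) (ks : List (Fin 4)) :
    pathEnd z (k :: ks) = pathEnd (z + cornerUnit k) ks := rfl

/-- The last direction of a concatenation with a nonempty second part. [folklore] -/
theorem lastDir_append_of_ne_nil (ks : List (Fin 4)) {ks' : List (Fin 4)} (hks' : ks' ≠ []) :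
    lastDir (ks ++ ks') = lastDir ks' := by
  unfold lastDir
  rw [List.getLastD_eq_getLast?, List.getLastD_eq_getLast?, List.getLast?_append_of_ne_nil _ hks']

/-- The last direction of a nonempty run. [folklore] -/
theorem lastDir_replicate_succ (n : ℕ) (k : Fin 4) : lastDir (List.replicate (n + 1) k) = k := by
  unfold lastDir
  rw [List.getLastD_eq_getLast?, List.replicate_succ', List.getLast?_append, List.getLast?_singleton]
  rfl

/-- The last direction of a singleton. [folklore] -/
@[simp] theorem lastDir_singleton (k : Fin 4) : lastDir [k] = k := rfl

/-- The last direction of a list with at least two elements ignores the first. [folklore] -/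
@[simp] theorem lastDir_cons_cons (k k' : Fin 4) (ks : List (Fin 4)) : lastDir (k :: k' :: ks) = lastDir (k' :: ks) := by
  simp [lastDir]

/-- A corner walk has at least one corner per step. [folklore] -/
theorem length_le_length_cornerWalk (z : Site 2) (a : Fin 4) (ks : List (Fin 4)) :
    ks.length ≤ (cornerWalk z a ks).length := by
  induction ks generalizing z a with
  | nil => simp
  | cons k ks ih =>
    rw [cornerWalk_cons, List.length_append, List.length_cons]
    have h1 : 1 ≤ (fanL z a (k + 3 - a).val).length := List.length_pos_of_ne_nil (fanL_ne_nil _ _ _)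
    have h2 := ih (z + cornerUnit k) (k + 2)
    omega

/-! ### Straight runs -/

/-- The end vertex of a straight run of `n` steps in direction `k`: `z + n • u_k`. [folklore] -/
theorem pathEnd_replicate (z : Site 2) (n : ℕ) (k : Fin 4) :
    pathEnd z (List.replicate n k) = z + (n : ℤ) • cornerUnit k := by
  induction n generalizing z with
  | zero => simp [pathEnd]
  | succ n ih =>
    rw [List.replicate_succ, pathEnd_cons, ih]
    push_cast
    rw [add_smul, one_smul]
    abel

/-- **The vertices of a straight run** are `z + i • u_k` for `i < n`. [folklore] -/
theorem mem_pathVerts_replicate {z v : Site 2} {n : ℕ} {k : Fin 4} :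
    v ∈ pathVerts z (List.replicate n k) ↔ ∃ i : ℕ, i < n ∧ v = z + (i : ℤ) • cornerUnit k := by
  induction n generalizing z with
  | zero => simp [pathVerts]
  | succ n ih =>
    rw [List.replicate_succ, pathVerts_cons, List.mem_cons, ih]
    constructor
    · rintro (rfl | ⟨i, hi, rfl⟩)
      · exact ⟨0, Nat.succ_pos _, by simp⟩
      · refine ⟨i + 1, by omega, ?_⟩
        push_cast
        rw [add_smul, one_smul]
        abel
    · rintro ⟨i, hi, rfl⟩
      rcases i with _ | i
      · left; simp
      · right
        refine ⟨i, by omega, ?_⟩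
        push_cast
        rw [add_smul, one_smul]
        abel

/-- Distinct multiples of a unit vector are distinct. [folklore] -/
theorem smul_cornerUnit_injective (k : Fin 4) : Function.Injective fun i : ℤ => i • cornerUnit k := by
  intro i j h
  have h0 := congr_fun h 0
  have h1 := congr_fun h 1
  fin_cases k <;> simp [cornerUnit] at h0 h1 <;> omega

/-- **A straight run has no repeated vertex.** [folklore] -/
theorem nodup_pathVerts_replicate (z : Site 2) (n : ℕ) (k : Fin 4) : (pathVerts z (List.replicate n k)).Nodup := by
  induction n generalizing z with
  | zero => exact List.nodup_nil
  | succ n ih =>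
    rw [List.replicate_succ, pathVerts_cons, List.nodup_cons]
    refine ⟨fun h => ?_, ih _⟩
    obtain ⟨i, -, hi⟩ := mem_pathVerts_replicate.1 h
    have : (0 : ℤ) • cornerUnit k = ((i : ℤ) + 1) • cornerUnit k := by
      rw [zero_smul, add_smul, one_smul]
      have := congrArg (fun w => w - z) hi
      simpa [add_comm, add_assoc, add_sub_cancel_left] using this
    have := smul_cornerUnit_injective k this
    omega

/-- **A straight run entered straight contributes no net turn, whatever follows**:
`walkTurns (k + 2) (replicate n k ++ rest) = walkTurns (k + 2) rest`. [folklore] -/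
theorem walkTurns_replicate_append (k : Fin 4) (n : ℕ) (rest : List (Fin 4)) :
    walkTurns (k + 2) (List.replicate n k ++ rest) = walkTurns (k + 2) rest := by
  induction n with
  | zero => rfl
  | succ n ih =>
    rw [List.replicate_succ, List.cons_append, walkTurns, ih]
    have : ∀ k : Fin 4, ((k + 3 - (k + 2)).val : ℕ) = 1 := by decide
    rw [this]
    norm_num

/-- The vertices of a run followed by more steps. [folklore] -/
theorem pathVerts_replicate_append (z : Site 2) (n : ℕ) (k : Fin 4) (rest : List (Fin 4)) :
    pathVerts z (List.replicate n k ++ rest) =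
      pathVerts z (List.replicate n k) ++ pathVerts (z + (n : ℤ) • cornerUnit k) rest := by
  rw [pathVerts_append, pathEnd_replicate]

/-- The end vertex of a run followed by more steps. [folklore] -/
theorem pathEnd_replicate_append (z : Site 2) (n : ℕ) (k : Fin 4) (rest : List (Fin 4)) :
    pathEnd z (List.replicate n k ++ rest) = pathEnd (z + (n : ℤ) • cornerUnit k) rest := by
  rw [pathEnd_append, pathEnd_replicate]

/-- Membership in the vertices of a run followed by more steps. [folklore] -/
theorem mem_pathVerts_replicate_append {z v : Site 2} {n : ℕ} {k : Fin 4} {rest : List (Fin 4)} :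
    v ∈ pathVerts z (List.replicate n k ++ rest) ↔
      (∃ i : ℕ, i < n ∧ v = z + (i : ℤ) • cornerUnit k) ∨ v ∈ pathVerts (z + (n : ℤ) • cornerUnit k) rest := by
  rw [pathVerts_replicate_append, List.mem_append, mem_pathVerts_replicate]

/-- **No repeated vertex in a run followed by more steps** iff the continuation has no repeated vertex
and avoids the run. [folklore] -/
theorem nodup_pathVerts_replicate_append {z : Site 2} {n : ℕ} {k : Fin 4} {rest : List (Fin 4)} :
    (pathVerts z (List.replicate n k ++ rest)).Nodup ↔
      (pathVerts (z + (n : ℤ) • cornerUnit k) rest).Nodup ∧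
        ∀ v ∈ pathVerts (z + (n : ℤ) • cornerUnit k) rest, ¬ ∃ i : ℕ, i < n ∧ v = z + (i : ℤ) • cornerUnit k := by
  rw [pathVerts_replicate_append, List.nodup_append]
  constructor
  · rintro ⟨-, h2, h3⟩
    refine ⟨h2, fun v hv hi => ?_⟩
    exact h3 _ (mem_pathVerts_replicate.2 hi) _ hv rfl
  · rintro ⟨h2, h3⟩
    refine ⟨nodup_pathVerts_replicate z n k, h2, fun v hv w hw hvw => ?_⟩
    subst hvw
    exact h3 v hw (mem_pathVerts_replicate.1 hv)

end Literature.Probability.LatticeModels
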